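import Mathlib
import HarnessLib
import Summits.ResolutionOfSingularities.ResolutionOfSingularities.Theorems.WildQuotientsWildQuotientResolutionS1aLinShear

/-!
# S1a — THE ELEMENTARY (GRAPH) SHEAR `x_v ↦ x_v + g` OF A FREE MODEL and K1′ of a GRAPH centre `(x_{v₀}, x_v − g)` in `k[x_ι][1/h]`

[OURS · L1 W4.5c · lead-1 g15; R4a (`tparab_killsIn_two`, plan-1 RULING R-F15n (2): «K1′ = the GRAPH LEMMA (φ = U − X₁² is a graph over the invariant
variable U, not a power of a variable)»); pattern ✓`exists_linShear` / ✓`isRegular_away_pair_of_algEquiv` (`…S1aLinShear`)] — NOT statements of the manuscript;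
counted 0; AI-level work, weaker than expert review. Crux stmt-ResolutionOfSingularities-17941 `CyclicQuotientFourfolds`, line `s1a-logminvertex` v13.

* `exists_elemShear` — for `g ∈ k[x_ι]` not involving `x_v` (hypothesis `hg`: every substitution fixing the other variables fixes `g`), the `k`-algebra
  automorphism `x_v ↦ x_v − g` (others fixed) with inverse `x_v ↦ x_v + g`;
* ★★ `isRegular_away_X_graph` — K1′ for the GRAPH centre `(x_{v₀}, x_v − g)` (`v₀ ≠ v`) in `k[x_ι][1/h]`, given a point `pt` with `pt_{v₀} = 0`,
  `pt_v = g(pt)` and `h(pt) ≠ 0`: the sequence is regular and the quotient is a regular ring.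
-/

set_option linter.dupNamespace false

noncomputable section

open MvPolynomial
open Summit.ResolutionOfSingularities.ResolutionOfSingularities.Theorems.WildQuotientResolution.S1

namespace Summit.ResolutionOfSingularities.ResolutionOfSingularities.Theorems.WildQuotientResolution.S1.FreeModel

variable (k : Type) [Field k] {ι : Type} [DecidableEq ι]

/-- **The elementary shear** `x_v ↦ x_v − g`, `g` not involving `x_v`, all other variables fixed, as a `k`-algebra automorphism of `k[x_ι]`, with its
inverse `x_v ↦ x_v + g`. [folklore] -/
theorem exists_elemShear (v : ι) (g : MvPolynomial ι k)
    (hg : ∀ f : ι → MvPolynomial ι k, (∀ l, l ≠ v → f l = X l) → aeval f g = g) :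
    ∃ α : MvPolynomial ι k ≃ₐ[k] MvPolynomial ι k, α (X v) = X v - g ∧ (∀ l, l ≠ v → α (X l) = X l) ∧
      α.symm (X v) = X v + g ∧ (∀ l, l ≠ v → α.symm (X l) = X l) := by
  let f : MvPolynomial ι k →ₐ[k] MvPolynomial ι k := aeval fun l => if l = v then X v - g else X l
  let f' : MvPolynomial ι k →ₐ[k] MvPolynomial ι k := aeval fun l => if l = v then X v + g else X l
  have hf0 : f (X v) = X v - g := by rw [aeval_X, if_pos rfl]
  have hf : ∀ l, l ≠ v → f (X l) = X l := fun l h => by rw [aeval_X, if_neg h]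
  have hg0 : f' (X v) = X v + g := by rw [aeval_X, if_pos rfl]
  have hg' : ∀ l, l ≠ v → f' (X l) = X l := fun l h => by rw [aeval_X, if_neg h]
  have hfg₀ : f g = g := hg _ fun l h => if_neg h
  have hgg₀ : f' g = g := hg _ fun l h => if_neg h
  have hfg : f.comp f' = AlgHom.id k _ := by
    refine algHom_ext fun l => ?_
    by_cases h : l = v
    · subst h
      rw [AlgHom.comp_apply, hg0, map_add, hf0, hfg₀, AlgHom.id_apply, sub_add_cancel]
    · rw [AlgHom.comp_apply, hg' l h, AlgHom.id_apply, hf l h]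
  have hgf : f'.comp f = AlgHom.id k _ := by
    refine algHom_ext fun l => ?_
    by_cases h : l = v
    · subst h
      rw [AlgHom.comp_apply, hf0, map_sub, hg0, hgg₀, AlgHom.id_apply, add_sub_cancel_right]
    · rw [AlgHom.comp_apply, hf l h, AlgHom.id_apply, hg' l h]
  exact ⟨AlgEquiv.ofAlgHom f f' hfg hgf, hf0, hf, hg0, hg'⟩

/-- ★★ **K1′ for the graph centre `(x_{v₀}, x_v − g)` in `k[x_ι][1/h]`**: `v₀ ≠ v`, `g` not involving `x_v`, and a point `pt` with `pt_{v₀} = 0`,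
`pt_v = g(pt)` and `h(pt) ≠ 0`. [OURS · L1 W4.5c · R4a, K1′ of a graph component; folklore] -/
theorem isRegular_away_X_graph [Finite ι] (hh : MvPolynomial ι k) (v₀ v : ι) (hv : v₀ ≠ v) (g : MvPolynomial ι k)
    (hg : ∀ f : ι → MvPolynomial ι k, (∀ l, l ≠ v → f l = X l) → aeval f g = g)
    (pt : ι → k) (hpt0 : pt v₀ = 0) (hptv : pt v = MvPolynomial.eval pt g) (hu : MvPolynomial.eval pt hh ≠ 0) :
    RingTheory.Sequence.IsRegular (Localization.Away hh)
        (List.ofFn (![algebraMap (MvPolynomial ι k) (Localization.Away hh) (X v₀), algebraMap (MvPolynomial ι k) (Localization.Away hh) (X v - g)] :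
          Fin 2 → Localization.Away hh)) ∧
      IsRegularRing (Localization.Away hh ⧸ Ideal.span (Set.range
        (![algebraMap (MvPolynomial ι k) (Localization.Away hh) (X v₀), algebraMap (MvPolynomial ι k) (Localization.Away hh) (X v - g)] :
          Fin 2 → Localization.Away hh))) := by
  classical
  obtain ⟨α, hα0, hα, -, -⟩ := exists_elemShear k v g hg
  refine isRegular_away_pair_of_algEquiv k hh v₀ v hv _ α.symm (by rw [AlgEquiv.symm_symm, hα _ hv]) (by rw [AlgEquiv.symm_symm, hα0])
    (fun i => MvPolynomial.eval pt (α (X i))) (by rw [hα _ hv, MvPolynomial.eval_X, hpt0])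
    (by rw [hα0, map_sub, MvPolynomial.eval_X, hptv, sub_self]) ?_
  have h := eval_point_algEquiv k α.symm pt hh
  simp only [AlgEquiv.symm_symm] at h
  rwa [h]

end Summit.ResolutionOfSingularities.ResolutionOfSingularities.Theorems.WildQuotientResolution.S1.FreeModel

end
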